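import Summits.QuantumFields.YangMills.Theorems.UnitScaleTiltProp7MemberCoshWeight
import HarnessLib

/-!
# Route `UnitScaleTilt`, crux K1 «MinimiserStabilityRegPr» (stmt-QuantumFields-19200), EX face S45 — (L3′b), ONE-FORM STOREY, FILE O4b:
# **THE COSH WEIGHT FAMILY ON THE BOND GRAPH — THE WEIGHT LETTERS OF O4 `pointwiseDecay_oneForm_of_letters` INSTANTIATED** (positivity, normalisation, supersolution with a
# K-uniform `λ ≥ 1∕2`, and the GROWTH letter `e^{κ′·d(p₁)} ≤ 8e^{3κ}·e^{κ′·d(p)}·W p₁ p` (all `0 ≤ κ′ ≤ κ`) against the block distance to any source block `v`)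

Cell `ym3-torus` (HUMAN RULING D-0037; rung R3 = SU(2) YM₃ on T³ — NOT d = 4, NOT infinite volume, NOT a mass gap, NOT Clay).  Chair seat ★`ym-ust-19200-p1` g26, own pen O4b.
THEOREMS ONLY (0 `def`, 0 `sorry`, default heartbeats); `--supports stmt-QuantumFields-19200 --as helper`; count-neutral.

THE FAMILY.  `W p₁ p := Π_μ cosh(a·circAbs_μ(p₁.1 − p.1))` — ★p1 g25's V4b-1 ✓`Prop7MemberCoshWeight` cosh product centred at the SITE `p₁.1` of the evaluation bond and read at the site
`p.1` (the direction index is a passenger: O3d's bond stencil `(y ∓ e_ν, μ)` keeps `μ`).  Rate `a ≤ μ₀η` per fine site from ✓`exists_weight_rate` (`λ = 1 − 6η⁻²(cosh a − 1) ≥ 1∕2`);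
`κ := a·ℓ ≤ μ₀` per block (`ηℓ = 1`); growth from ✓`exp_blockDist_le_weight` and the triangle inequality of the coarse `ℓ¹` torus distance.
WHAT IS PROVED (ns `Summit.QuantumFields.YangMills.Theorems.Prop7OneFormCoshFamily`).
* `bondEquiv_symm_src` — `((bondEquiv F K)⁻¹ p).src = (siteEquiv F K)⁻¹ p.1` (bridge to O4a's block partition).
* ★★★ `exists_coshFamily (hnK) (hμ₀ : 0 < μ₀) (v)` — `∃ κ λ W`, `0 < κ ≤ μ₀`, `1∕2 ≤ λ`, `W > 0`, O3d's `hsup` VERBATIM, `W p₁ p₁ = 1`, and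
  the FLOOR `(1∕8)e^{−3κ}·e^{κ·tdist(B p₁, B p)} ≤ W p₁ p` (blocks of the source sites), and `e^{κ′·d p₁} ≤ (8·e^{3κ})·e^{κ′·d p}·W p₁ p` for EVERY `0 ≤ κ′ ≤ κ`, with `d p := tdist(B((bondEquiv)⁻¹ p).src, v)` — the four weight binders `hW hsup hW1 hWd` of O4 ✓-typed `pointwiseDecay_oneForm_of_letters`
  (`lam := λ`, `Cg := 8e^{3κ} ≤ 8e^{3μ₀}`, K-FREE).
HONEST SCOPE.  Weight bookkeeping (no operator occurs); nothing of the ten EX rows, `hT`, (3.42), EX or the crux is proved here.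

References: T. Bałaban, CMP **95** (1984) 17–40 [Balaban1984PropagatorsI] (p.36, the Agmon weight; Prop. 1.1 p.33); CMP **99** (1985) 389–434 [Balaban1985BackgroundPropagators]
(Thm 3.1 (3.42) p.397, «constants dependent on d and L only»).
-/

set_option autoImplicit false

noncomputable section

open scoped BigOperators

namespace Summit.QuantumFields.YangMills.Theorems.Prop7OneFormCoshFamily

open Literature.MathematicalPhysics.QuantumFieldTheory.Balaban1983to89
open Literature.MathematicalPhysics.QuantumFieldTheory.Balaban1983to89.T3ContinuumYM3Torus
open T3SectALandauChart (eta eta_pos)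
open B5Eq118OneStroke (iterBlockOf)
open B4Sect5Torus (TSite)
open B9SectCLatticeCarrier (Bond shift unshift)
open B4TorusKernel.MultiPeriod (circAbs)
open B9Eq342CoshWeightSite (weight_site_pos weight_site_centre)
open B3Taylor310LocalRemainder (tdist_triangle)
open Summit.QuantumFields.YangMills.Theorems.Prop7SectET3Transport (periodsT3 siteEquiv bondEquiv bondEquiv_symm_apply)
open Summit.QuantumFields.YangMills.Theorems.Prop7BlockDistanceWeights (eta_mul_pow_eq_one)
open Summit.QuantumFields.YangMills.Theorems.Prop7MemberCoshWeight (weight_supersolution_member exists_weight_rate exp_blockDist_le_weight)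

variable (F : T3Family) (n K : ℕ)

/-- The source site of a chart bond read back on the route: `((bondEquiv F K)⁻¹ p).src = (siteEquiv F K)⁻¹ p.1`. [folklore] -/
theorem bondEquiv_symm_src (p : Bond 3 (periodsT3 F K)) : ((bondEquiv F K).symm p).src = (siteEquiv F K).symm p.1 := by
  rw [bondEquiv_symm_apply]

/-- ★★★ **THE COSH WEIGHT FAMILY ON THE BOND GRAPH** — for every `μ₀ > 0` and every source block `v`: a rate `0 < κ ≤ μ₀` per block, a K-uniform `λ ≥ 1∕2`, and the family
`W p₁ p = Π_μ cosh(a·circAbs_μ(p₁.1 − p.1))` (`κ = aℓ`) which is positive, normalised (`W p₁ p₁ = 1`), a `λ`-supersolution of the flat `η⁻²`-stencil of the bond graph at every centre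
(O3d's `hsup` VERBATIM), has the FLOOR `(1∕8)e^{−3κ}e^{κ·tdist(B p₁, B p)} ≤ W p₁ p` (the `hWfloor` of the `E_W` supplier), and satisfies the GROWTH letter `e^{κ′·d p₁} ≤ (8e^{3κ})·e^{κ′·d p}·W p₁ p` (every rate `0 ≤ κ′ ≤ κ`) for the block distance `d p = tdist(B((bondEquiv)⁻¹p).src, v)` to the source block —
the weight binders `hW hsup hW1 hWd` of O4 `Prop7OneFormPointwiseDecay.pointwiseDecay_oneForm_of_letters`.
[cite: Balaban1984PropagatorsI, p.36, Prop. 1.1 p.33; Balaban1985BackgroundPropagators, Thm 3.1 (3.42) p.397] -/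
theorem exists_coshFamily (hnK : n ≤ K) {μ₀ : ℝ} (hμ₀ : 0 < μ₀) (v : Site (F.P K) (K - n)) :
    ∃ (κ lam : ℝ) (W : Bond 3 (periodsT3 F K) → Bond 3 (periodsT3 F K) → ℝ),
      0 < κ ∧ κ ≤ μ₀ ∧ (1 : ℝ) / 2 ≤ lam ∧ (∀ p₁ p, 0 < W p₁ p) ∧
      (∀ p₁ p, lam * W p₁ p ≤ ∑ j : Fin 3 ⊕ Fin 3, (eta F n K)⁻¹ ^ 2 *
          (W p₁ p - W p₁ (Sum.elim (fun ν => unshift ν p.1) (fun ν => shift ν p.1) j, p.2)) + 1 * W p₁ p) ∧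
      (∀ p₁, W p₁ p₁ = 1) ∧
      (∀ p₁ p, (1 / 8) * Real.exp (-(3 * κ)) * Real.exp (κ * (Site.tdist (iterBlockOf (K - n) ((bondEquiv F K).symm p₁).src)
          (iterBlockOf (K - n) ((bondEquiv F K).symm p).src) : ℝ)) ≤ W p₁ p) ∧
      (∀ κ' : ℝ, 0 ≤ κ' → κ' ≤ κ → ∀ p₁ p, Real.exp (κ' * (Site.tdist (iterBlockOf (K - n) ((bondEquiv F K).symm p₁).src) v : ℝ))
          ≤ (8 * Real.exp (3 * κ)) * Real.exp (κ' * (Site.tdist (iterBlockOf (K - n) ((bondEquiv F K).symm p).src) v : ℝ)) * W p₁ p) := by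
  obtain ⟨a, ha0, haμ, -, hlam⟩ := exists_weight_rate F n K hμ₀
  have hL1 : (1 : ℝ) < (F.L : ℝ) := by exact_mod_cast F.hL.2
  have hℓ : 0 < (F.L : ℝ) ^ (K - n) := pow_pos (by linarith) _
  have hηℓ : eta F n K * (F.L : ℝ) ^ (K - n) = 1 := eta_mul_pow_eq_one F (n := n) (K := K)
  refine ⟨a * (F.L : ℝ) ^ (K - n), 1 - 2 * (3 : ℕ) * (eta F n K)⁻¹ ^ 2 * (Real.cosh a - 1),
    fun p₁ p => ∏ μ, Real.cosh (a * (circAbs (periodsT3 F K μ)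
      (((((p₁.1 μ : ℕ) : ZMod (periodsT3 F K μ)) - ((p.1 μ : ℕ) : ZMod (periodsT3 F K μ))).val : ℕ) : ℤ) : ℝ)),
    mul_pos ha0 hℓ, ?_, hlam, fun p₁ p => weight_site_pos (periodsT3 F K) a p₁.1 p.1,
    fun p₁ p => weight_supersolution_member F n K a p₁.1 p.1, fun p₁ => weight_site_centre (periodsT3 F K) a p₁.1, ?_, ?_⟩
  · -- `aℓ ≤ μ₀ηℓ = μ₀`
    calc a * (F.L : ℝ) ^ (K - n) ≤ μ₀ * eta F n K * (F.L : ℝ) ^ (K - n) := mul_le_mul_of_nonneg_right haμ hℓ.le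
      _ = μ₀ := by rw [mul_assoc, hηℓ, mul_one]
  · -- the FLOOR: ✓`exp_blockDist_le_weight` read through `siteEquiv`
    intro p₁ p
    have hdom := exp_blockDist_le_weight F n K hnK ha0.le ((siteEquiv F K).symm p₁.1) ((siteEquiv F K).symm p.1)
    rw [show siteEquiv F K ((siteEquiv F K).symm p₁.1) = p₁.1 from (siteEquiv F K).apply_symm_apply _,
      show siteEquiv F K ((siteEquiv F K).symm p.1) = p.1 from (siteEquiv F K).apply_symm_apply _] at hdom
    rw [bondEquiv_symm_src F K p₁, bondEquiv_symm_src F K p]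
    exact hdom
  · intro κ' hκ'0 hκ'κ p₁ p
    set κ : ℝ := a * (F.L : ℝ) ^ (K - n) with hκ
    set x₁ : Site (F.P K) 0 := (siteEquiv F K).symm p₁.1 with hx₁
    set x : Site (F.P K) 0 := (siteEquiv F K).symm p.1 with hx
    have e₁ : ((bondEquiv F K).symm p₁).src = x₁ := bondEquiv_symm_src F K p₁
    have e : ((bondEquiv F K).symm p).src = x := bondEquiv_symm_src F K p
    rw [e₁, e]
    -- the weight dominates the block-distance exponential between the two bonds' blocks
    have hdom := exp_blockDist_le_weight F n K hnK ha0.le x₁ x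
    rw [show siteEquiv F K x₁ = p₁.1 from (siteEquiv F K).apply_symm_apply _,
      show siteEquiv F K x = p.1 from (siteEquiv F K).apply_symm_apply _] at hdom
    -- triangle inequality for the coarse distance
    have htri : (Site.tdist (iterBlockOf (K - n) x₁) v : ℝ)
        ≤ (Site.tdist (iterBlockOf (K - n) x₁) (iterBlockOf (K - n) x) : ℝ) + (Site.tdist (iterBlockOf (K - n) x) v : ℝ) := by
      exact_mod_cast tdist_triangle (iterBlockOf (K - n) x₁) (iterBlockOf (K - n) x) v
    have hW0 := weight_site_pos (periodsT3 F K) a p₁.1 p.1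
    have hd0 : (0 : ℝ) ≤ (Site.tdist (iterBlockOf (K - n) x₁) (iterBlockOf (K - n) x) : ℝ) := Nat.cast_nonneg _
    calc Real.exp (κ' * (Site.tdist (iterBlockOf (K - n) x₁) v : ℝ))
        ≤ Real.exp (κ * (Site.tdist (iterBlockOf (K - n) x₁) (iterBlockOf (K - n) x) : ℝ)) * Real.exp (κ' * (Site.tdist (iterBlockOf (K - n) x) v : ℝ)) := by
          rw [← Real.exp_add, Real.exp_le_exp]; nlinarith [mul_le_mul_of_nonneg_right hκ'κ hd0]
      _ = (8 * Real.exp (3 * κ)) * Real.exp (κ' * (Site.tdist (iterBlockOf (K - n) x) v : ℝ))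
            * ((1 / 8) * Real.exp (-(3 * (a * (F.L : ℝ) ^ (K - n)))) * Real.exp (a * (F.L : ℝ) ^ (K - n) * (Site.tdist (iterBlockOf (K - n) x₁) (iterBlockOf (K - n) x) : ℝ))) := by
          have h8 : Real.exp (3 * κ) * Real.exp (-(3 * (a * (F.L : ℝ) ^ (K - n)))) = 1 := by rw [← Real.exp_add, hκ, add_neg_cancel, Real.exp_zero]
          calc Real.exp (κ * (Site.tdist (iterBlockOf (K - n) x₁) (iterBlockOf (K - n) x) : ℝ)) * Real.exp (κ' * (Site.tdist (iterBlockOf (K - n) x) v : ℝ))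
              = Real.exp (κ * (Site.tdist (iterBlockOf (K - n) x₁) (iterBlockOf (K - n) x) : ℝ)) * Real.exp (κ' * (Site.tdist (iterBlockOf (K - n) x) v : ℝ))
                  * (Real.exp (3 * κ) * Real.exp (-(3 * (a * (F.L : ℝ) ^ (K - n))))) := by rw [h8, mul_one]
            _ = _ := by rw [hκ]; ring
      _ ≤ (8 * Real.exp (3 * κ)) * Real.exp (κ' * (Site.tdist (iterBlockOf (K - n) x) v : ℝ))
            * ∏ μ, Real.cosh (a * (circAbs (periodsT3 F K μ)
                (((((p₁.1 μ : ℕ) : ZMod (periodsT3 F K μ)) - ((p.1 μ : ℕ) : ZMod (periodsT3 F K μ))).val : ℕ) : ℤ) : ℝ)) :=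
          mul_le_mul_of_nonneg_left hdom (by positivity)

end Summit.QuantumFields.YangMills.Theorems.Prop7OneFormCoshFamily

end
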